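import Mathlib
import HarnessLib
import HarnessLib.Audit
import Summits.Ventures.CertifiedManyBodySolver.Observables.RungLeavesCoverageNdNiO2Cut

/-!
Route: CovNdNiO2M21

DORMANT since 2026-09-03T06:23:10Z (reconciler: no traction for 5 d (last activity item-evidence-added at 2026-08-29T05:49:06Z); parked, not closed — `ledger route dormant route-Ventures-CovNdNiO2M21 --off` to reactivate) — unstaffed, not closed; items shared with open routes are served there. `ledger route dormant <id> --off` reactivates.

# Route CovNdNiO2M21 — hubbard-cov-ndnio2-1 — certified T = 0 flux-stiffness ceiling below 0.98 ×
kinematic on the NdNiO₂ parent-film box M21, owed only on the residual corner cell, from two f-sum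
apex-station U-slabs

It suffices to show X = ResidualLowUSlab ∧ ResidualHighUSlab: on the RESIDUAL CORNER CELL t′/t ∈
[−23/50, −11/25] × U/t ∈ [5, 17/2] ×
n ∈ [9/10, 477/500] of the downfolded one-band box of the infinite-layer NdNiO₂ parent film (VSET
M21, object E, words «1BH+3BE»,
`boxNdNiO2E_M21` = U/t ∈ [5, 17/2] × t′/t ∈ [−23/50, −9/25] × n ∈ [213/250, 477/500]) the
thermodynamic-limit uniform-flux stiffness admits
the certified CEILING c = 0.4779578 (= 0.98 × the box kinematic word κ₂₁ = 0.4877121,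
`boxNdNiO2E_M21_stiffness_kinematic`, rounded down at
the 7th decimal), split into the LOW-U slab U/t ∈ [5, 13/2] (contains the binding corner (5, −23/50,
477/500)) and the HIGH-U slab
U/t ∈ [13/2, 17/2]. The rest of the box (≈ 89 % of the (t′, n) face) is node-free kinematics already
below the bar and PROVED in the tree
(`NdNiO2M21_StiffnessBoxCeiling_of_cornerCellLeaf`, box-2 p607598), so the pair is the registered
rung leaf «MOS2-ndnio2-M21».
Lean: `Summit.Ventures.CertifiedManyBodySolver.Theses.CovNdNiO2M21.ResidualLowUSlab ∧
Summit.Ventures.CertifiedManyBodySolver.Theses.CovNdNiO2M21.ResidualHighUSlab`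

## Assembly
Pure logic plus the tree's corner-cell discharger: `le_total U (13/2)` splits the residual cell's
U-interval [5, 17/2] into the two slabs, giving
the cell leaf `∀ tp U n ∈ residual cell, ObsStiffnessSeqCeilingAt tp U n c` with c = 4779578/10⁷ ≤
bar (`le_rfl`), and
`NdNiO2M21_StiffnessBoxCeiling_of_cornerCellLeaf` (box-2 p607598: shallow part
`ndnio2_M21_shallowCell_kinematic` 0.4768946 and low fillings
`ndnio2_M21_lowFillingCell_kinematic` 0.4736879, both node-free kernel theorems below the bar)
concludes the registered leaf. The deciding
theorem is `closes` in glue.lean (elaborates: Sketch.lean `lean check` rc 0, 0 sorry, 2026-08-28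
06:1xZ).

CLOSES_TARGET: closes rung MO-S2 of Ventures/CertifiedManyBodySolver: Summit.Ventures.CertifiedManyBodySolver.Observables.NdNiO2M21_StiffnessBoxCeiling (D-0061; not the summit Statement) — the deciding theorem of this route concludes that registered leaf (Ventures/CertifiedManyBodySolver: no summit Statement) (class rung: servable and labelled, never counted as concluding the summit Statement).

Rationale: WHY THIS LINE. The mechanism is the f-sum (odd-moment) CEILING on the flux stiffness
(ScalapinoWhiteZhang1993 §II; HazraVermaRanderia2019 eqs. (2)–(6);
ParamekantiTrivediRanderia1998): ρ_s ≤ ⟨X₀(t′, U)⟩, whose thermodynamic-limit ground-state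
expectation is bounded by a certified moment/RDM
window at ONE station (s, U_A, n) and transported over a (t′, U) rectangle and a density interval by
the apex-station theorems in tree
(`ObsStiffnessSeqCeilingAt_on_box3_of_apexStation_twoEndObjectives`,
`Observables/RungLeavesCoverageNdNiO2Residual.lean` §3: U-monotonicity
along the Hellmann–Feynman orbit plus the σ-chord of two END objectives −X₀(−23/50, U_A),
−X₀(−11/25, U_A); no K₂ input). Imported from
many-body sum-rule theory and convex optimisation (exact rational SDP duals, arXiv:2310.05844);
nothing probabilistic. What it does that the
La214 / Hg-1201 coverage routes do not: the box is a NICKELATE parent (self-doped, n up to 0.954,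
|t′/t| up to 0.46, BotanaNorman2020,
KitataniEtAl2020NickelateOneBand) whose kinematic cover is already a theorem, so the route's entire
content is the 9/85 corner cell where the
one-body majorant is within 0.63 % of the bar — a pure test of certified window resolution at a
frustrated, nearly half-filled, U/t = 5 point.

RANKED CRUXES. #2 ResidualLowUSlab (crux) — on the low-U slab U/t ∈ [5, 13/2] of the residual corner
cell, for every t′/t ∈ [−23/50, −11/25] and n ∈ [9/10, 477/500], the uniform-flux stiffness ceiling
`ObsStiffnessSeqCeilingAt tp U n (4779578/10⁷)` holds (intended witness: ONE station at U_A = 5, two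
END objectives −X₀(−23/50, 5) / −X₀(−11/25, 5), slots σ ∈ [−23/50, −11/25], sources s ∈ [16σ/13, σ]
⊂ [−184/325, −11/25], densities read on [9/10, 477/500] from interval-valid rows; BC3 skeleton
`bc/ResidualLowUSlab_birth.lean`). [difficulty: L] (why it might fail: WINDOW-LIMITED: at the far
source (5, −184/325, 0.954) the certified ⟨X₀⟩ must land within ≈ +5–7 % of its free value while no
certified torus-limit energy CAP exists today at any doped t′ ≤ −0.44 point
(EnergyWindowCeilingResolution; √δ sensitivity a ≈ 0.1).) [HazraVermaRanderia2019,
ScalapinoWhiteZhang1993, arXiv:2310.05844, KomaTasaki1994]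
#3 ResidualHighUSlab (crux) — the same ceiling on the high-U slab U/t ∈ [13/2, 17/2] of the residual
corner cell (intended witness: ONE station at U_A = 13/2, the same two END objectives at U_A = 13/2,
sources s ∈ [21σ/17, σ] ⊂ [−483/850, −11/25]; alternatively the U_A = 5 station's overhang to
−276/425 via `NdNiO2M21_StiffnessBoxCeiling_of_residualStation5Rows_and_kinCover`; BC3 skeleton
`bc/ResidualHighUSlab_birth.lean`). [difficulty: M] (why it might fail: at U/t = 13/2–17/2, n ≥ 0.9
the point is Mott-proximate: moment windows widen with U faster than the kinetic suppression grows,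
and no station parent or cap has ever been produced at (13/2, s ≤ −0.44, n ≈ 0.95); a slack above ≈
0.02 t in ⟨X₀⟩ kills the margin.) [HazraVermaRanderia2019, arXiv:2310.05844, KomaTasaki1994,
ParamekantiTrivediRanderia1998]

TWO-LAYER PLAN. Foreseen glued splits (nothing filed now): ResidualLowUSlab ⇐ StationP5 → StationQ5
→ Price5 → ResidualLowUSlab (the two END-objective
orbit-lower row families + caps + σ-chord price of `…_of_residualStation5Rows_and_kinCover`
restricted to U_max = 13/2; glue kernel-checked in
`bc/ResidualLowUSlab_birth.lean`); ResidualHighUSlab the same at U_A = 13/2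
(`ndnio2_M21_split13o2_geometry`), OR discharged by the U_A = 5
family's overhang to s = −276/425 if that certifies (then one station closes both slabs and the
split is bookkeeping). The any-density obligation
(captain K3, referee f1′) lives INSIDE each slab's ∀ n: rows feeding the discharger are
`Rows/DopedTLCorrBoxWindow` cell rows ⊇ [9/10, 477/500] or
WN rows with the filling-multiplier slope printed and the window discharged at both density edges —
point rows at one density do not discharge ∀ n.

KILL CRITERIA. ROUTE-KILL witness (referee hubbard-cov-ndnio2-ref-1 wording, ADOPTED (ooo4)): a
certified torus-limit ground-state FLOOR on ⟨X₀(−23/50, 5)⟩ (or on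
the σ-chord of the two END objectives) ABOVE 0.4779578 at a point of the residual cell — then no
f-sum / orbit-lower edition can close there and
the line as drawn is dead (close --reason refuted-line; pivot = an F-keyed pointwise leaf typed
BESIDE «MOS2-ndnio2-M21», never a re-key, or a
director bar). ITEM REFUTATION of ResidualLowUSlab / ResidualHighUSlab as typed = a certified
flux-STIFFNESS floor above the bar (a uniform-in-L
lower bound E_L(θ) − E_L(0) ≥ ρθ² in the sector) — not producible by any instrument of record for
the repulsive model
(StiffnessFloorInvisibleToSpectralMoments). The REALISTIC failure is INSTRUMENTAL: the certified
corner value c lands above the bar with a tight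
window (then the leaf stays OPEN and c is banked as a CONTROL number with its companion ratio c/F),
or cap-limited (no doped energy cap; W1).
A proved ResidualHighUSlab with ResidualLowUSlab open moots nothing: it is banked as the [13/2,
17/2] sub-cell word.

NOT DECOMPOSED YET. The station families (values vP, vQ per density edge or interval-valid rows rP,
rT under a cap u), the density reading (cell rows or WN rows with
printed filling multipliers), the EXT5-L⁺ / GENONLY parents at the NdNiO₂ stations (5, s, n) and
(13/2, s, n), the doped energy CAP producer
(one cap producer for three materials, downfold referral), and the exact rational certificate format
are layer-2 / producer business (seats
`hubbard-cov-ndnio2-gen-1`, `-box-1…2`, `-sdp-1…2`, referee `-ref-1`, captain `-plan-1`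
NDNIO2-COVERAGE-PLAN v0.3); the slab split point
U_s = 13/2 is a free parameter the captain may move (re-split, not a new route), and a ONE-station
edition closing both slabs is welcome.

CHEAPEST FALSIFIER. Done by the captain and the referee [float, not of record]: the free / one-body
table of NDNIO2-COVERAGE-PLAN §2–§3 — no END-objective source,
slot or density of the residual cell has its FREE value above the bar (minimum room +4.9 % at the
far source (5, −276/425, 0.954), +7.4 % at the
corner); a full own-slot read at the far source WOULD exceed it (0.4906) — hence END objectives
only. The first solver datum is «NDS-A» L1a
(hubbard-cov-ndnio2-sdp-1, PRE-REG 05:45:42Z 08-28): the corner certificate −X₀(−23/50) at (5,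
477/500); PASS word iff c ≤ 0.4779578.

NUMBERS. Box kinematic word κ₂₁ = 0.4877121 (tree, `Downfold/BoxesNdNiO2EStiffnessKinematic.lean`, M
= 128 kernel table); bar 0.98 × ↦ 4779578/10⁷
(`ndnio2_M21_bar_arith`); cut constants 0.4768946 (shallow t′ ≥ −11/25) and 0.4736879 (n ≤ 9/10)
below the bar (`ndnio2_cut_constants_below_bars`,
`ndnio2_lowFilling_constants_below_bars`); residual corner cell = 9/85 of the (t′, n) face
(`ndnio2_residual_corner_fractions`); binding corner
float kinematic 0.4809983 (+0.63 % over the bar), free-fermion value there 0.4452 (7.4 % under the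
bar) — interim clause: content = below
0.98 × the kinematic MAJORANT word; no suppression-below-free is claimed. Twin M22 (Nd₀.₈Sr₀.₂NiO₂):
κ₂₂ 0.4509038, bar 4418857/10⁷, not in this route.

DEFINITION REQUESTS. None: every notion is in tree (`ObsStiffnessSeqCeilingAt`,
`StiffnessBoxCeilingBelow`, `boxNdNiO2E_M21`, the apex-station and residual-cover theorems).

Novelty: Searches (2026-08-28): `lit search --hybrid "upper bound superfluid stiffness kinetic energy f-sum
rule Hubbard model" -n 6` ([corpus:book:lipparini2008 pp. 464–465], [corpus:book:griffin1995 p.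
470], [corpus:book:lieb2005 p. 169]); `lit galaxy search "superfluid stiffness bound|upper bound on
the superfluid" --star pdf -n 6` ([galaxy:pdf:5090094321543315700] Leggett's bound;
[galaxy:pdf:4957438413378348860] Saslow–Galli–Reatto); `lit search "nickelate NdNiO2 Hubbard
one-band superfluid stiffness"` (provenance class only: BotanaNorman2020,
KitataniEtAl2020NickelateOneBand, ParzyckEtAl2025NdNiO2Parent — no rigorous stiffness bound on a
nickelate model in print); tree: `rg NdNiO2M21_StiffnessBoxCeiling` (p606882 leaf, p607201 / p607598
/ box-1 residual dischargers only; no route).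
Nearest prior art found: HazraVermaRanderia2019 (PRX 9, 031049: D_s ≤ kinetic bound, float
numerics), Leggett's variational upper bound [galaxy:pdf:5090094321543315700], the programme's own
La214 obligation `Downfold/BoxesLa214V115M2b` and the Hg-1201 draft CovHg1201M19b (arXiv:2310.05844
for the SDP side).
Delta: the same certified sum-rule ceiling transported over a doped NICKELATE box whose kinematic
cover is already a theorem, so the obligation is the 9/85 residual corner cell alone; a registration
(crew rung route) on a third material, not a mechanism.
Claimed grade: known  [refs: 2310.05844, book:lipparini2008, book:griffin1995, book:lieb2005, BotanaNorman2020, HazraVermaRanderia2019]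

Barriers (technique_class: sdp-lower-bound, sum-rule-moment-ceiling, box-transport): - technique_class: sdp-lower-bound, sum-rule-moment-ceiling, box-transport
- Literature.Barriers.HubbardSuperconductivity.StiffnessFloorInvisibleToSpectralMoments: conceded
and irrelevant — the route claims CEILINGS only, which is exactly what finitely many moments give;
it is also why an ITEM refutation (a stiffness floor) is not producible.
- Literature.Barriers.HubbardSuperconductivity.EnergyWindowCeilingResolution: inside its class and
load-bearing — the ceiling resolves only down to the window slack; the bet is that the f-sum station
windows at U_A ∈ {5, 13/2} on END objectives have slack below ≈ 0.02 t in ⟨X₀⟩ at n ∈ [0.9, 0.954];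
both cruxes' why-might-fail are this barrier priced, and the missing doped energy cap (W1) is its
current form.
- Literature.Barriers.HubbardSuperconductivity.DegreeFourSosMissesSecondOrderPerturbation: LESS
biting than at Hg-1201's U/t = 7/2 — no suppression below the free value needs certifying anywhere
on this box (bar sits 7.4 % above free at the binding corner); it bites only through the absolute
window width at U/t ≥ 5.
- Literature.Barriers.HubbardSuperconductivity.SignProblemNPHard: outside its class — exact rational
dual certificates, nothing sampled.
- Literature.Barriers.HubbardSuperconductivity.OrderParameterInvisibleToGroundStateConstraints:
conceded, irrelevant (no order-parameter floor claimed).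
- Negatives index: `ledger negatives --problem Ventures` / `--problem HubbardSuperconductivity` — no
refuted statement concerns a stiff

History (route lifecycle, newest last):
- 2026-09-03T06:23:10Z · DORMANT — reconciler: no traction for 5 d (last activity item-evidence-added at 2026-08-29T05:49:06Z); parked, not closed — `ledger route dormant route-Ventures-CovNdNiO2 (operator:999:700357)

sub-problem: CertifiedManyBodySolver · status: dormant · opened planner-hubbard-cov-ndnio2-plan-1-0 2026-08-28T07:43:54Z · rev 0 · ledger route-Ventures-CovNdNiO2M21
GENERATED by the gate from the ledger (D-0016/17). Provers cite these decls: `theorem foo : Summit.Ventures.CertifiedManyBodySolver.Theses.CovNdNiO2M21.<Decl> := …` in Summits/Ventures/CertifiedManyBodySolver/Theorems/<Name>.lean.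
-/

namespace Summit.Ventures.CertifiedManyBodySolver.Theses.CovNdNiO2M21

open scoped BigOperators Topology Manifold Classical MeasureTheory ProbabilityTheory Matrix InnerProductSpace ComplexConjugate ContinuousMap
open Filter Set Function TopologicalSpace MeasureTheory

-- H21.Audit: Ventures rung route — no summit Statement decl; the expected conclusion is the closer leaf tagged below
attribute [summit_statement] _root_.Summit.Ventures.CertifiedManyBodySolver.Observables.NdNiO2M21_StiffnessBoxCeiling

/-- item stmt-Ventures-26751 · crux · rank 2 · open · by planner
why it might fail: WINDOW-LIMITED: at the far source (5, −184/325, 0.954) the certified ⟨X₀⟩ must land within ≈ +5–7 % of its free value while no certified torus-limit energy CAP exists today at any doped t′ ≤ −0.44 point (EnergyWindowCeilingResolution; √δ sensitivity a ≈ 0.1).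
sources: HazraVermaRanderia2019, ScalapinoWhiteZhang1993, arXiv:2310.05844, KomaTasaki1994
[crux] on the low-U slab U/t ∈ [5, 13/2] of the residual corner cell, for every t′/t ∈ [−23/50,
−11/25] and n ∈ [9/10, 477/500], the uniform-flux stiffness ceiling `ObsStiffnessSeqCeilingAt tp U n
(4779578/10⁷)` holds (intended witness: ONE station at U_A = 5, two END objectives −X₀(−23/50, 5) /
−X₀(−11/25, 5), slots σ ∈ [−23/50, −11/25], sources s ∈ [16σ/13, σ] ⊂ [−184/325, −11/25], densities
read on [9/10, 477/500] from interval-valid rows; BC3 skeleton `bc/ResidualLowUSlab_birth.lean`).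
[difficulty: L] -/
@[route_item "route-Ventures-CovNdNiO2M21"]
def ResidualLowUSlab : Prop :=
  ∀ tp ∈ Set.Icc (-23 / 50 : ℝ) (-11 / 25), ∀ U ∈ Set.Icc (5 : ℝ) (13 / 2), ∀ n ∈ Set.Icc (9 / 10 : ℝ) (477 / 500), Summit.Ventures.CertifiedManyBodySolver.Observables.ObsStiffnessSeqCeilingAt tp U n (4779578 / 10000000)

/-- item stmt-Ventures-26752 · crux · rank 3 · open · by planner
why it might fail: at U/t = 13/2–17/2, n ≥ 0.9 the point is Mott-proximate: moment windows widen with U faster than the kinetic suppression grows, and no station parent or cap has ever been produced at (13/2, s ≤ −0.44, n ≈ 0.95); a slack above ≈ 0.02 t in ⟨X₀⟩ kills the margin.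
sources: HazraVermaRanderia2019, arXiv:2310.05844, KomaTasaki1994, ParamekantiTrivediRanderia1998
[crux] the same ceiling on the high-U slab U/t ∈ [13/2, 17/2] of the residual corner cell (intended
witness: ONE station at U_A = 13/2, the same two END objectives at U_A = 13/2, sources s ∈ [21σ/17,
σ] ⊂ [−483/850, −11/25]; alternatively the U_A = 5 station's overhang to −276/425 via
`NdNiO2M21_StiffnessBoxCeiling_of_residualStation5Rows_and_kinCover`; BC3 skeleton
`bc/ResidualHighUSlab_birth.lean`). [difficulty: M] -/
@[route_item "route-Ventures-CovNdNiO2M21"]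
def ResidualHighUSlab : Prop :=
  ∀ tp ∈ Set.Icc (-23 / 50 : ℝ) (-11 / 25), ∀ U ∈ Set.Icc (13 / 2 : ℝ) (17 / 2), ∀ n ∈ Set.Icc (9 / 10 : ℝ) (477 / 500), Summit.Ventures.CertifiedManyBodySolver.Observables.ObsStiffnessSeqCeilingAt tp U n (4779578 / 10000000)

/-- item stmt-Ventures-26753 · assembly · rank 1 · closed · proved by Summit.Ventures.CertifiedManyBodySolver.Theorems.covNdNiO2M21Assembly_proof (prover) · by planner
sources: ScalapinoWhiteZhang1993
[assembly] ResidualLowUSlab → ResidualHighUSlab → the rung leaf NdNiO2M21_StiffnessBoxCeiling -/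
@[route_item "route-Ventures-CovNdNiO2M21"]
def Assembly : Prop :=
  Summit.Ventures.CertifiedManyBodySolver.Theses.CovNdNiO2M21.ResidualLowUSlab → Summit.Ventures.CertifiedManyBodySolver.Theses.CovNdNiO2M21.ResidualHighUSlab → Summit.Ventures.CertifiedManyBodySolver.Observables.NdNiO2M21_StiffnessBoxCeiling

-- `Assembly` holds: proved by `Summit.Ventures.CertifiedManyBodySolver.Theorems.covNdNiO2M21Assembly_proof` (its module imports this route file, so no `_holds` link can be stated here).

/-! D-0027 §2.1 — DECIDING THEOREM (planner-authored via `route open/edit --closes-file`; by planner-hubbard-cov-ndnio2-plan-1-0 2026-08-28T07:43:54Z):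
its hypotheses are this route's items and its conclusion the registered leaf `Summit.Ventures.CertifiedManyBodySolver.Observables.NdNiO2M21_StiffnessBoxCeiling` (rung MO-S2, D-0061) (glue_lint), and it elaborates with this file. -/

@[closes "route-Ventures-CovNdNiO2M21"] theorem closes (h₁ : ResidualLowUSlab) (h₂ : ResidualHighUSlab) :
    Summit.Ventures.CertifiedManyBodySolver.Observables.NdNiO2M21_StiffnessBoxCeiling :=
  Summit.Ventures.CertifiedManyBodySolver.Observables.NdNiO2M21_StiffnessBoxCeiling_of_cornerCellLeaf le_rfl
    fun tp htp U hU n hn => by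
      rcases le_total U (13 / 2) with h | h
      · exact h₁ tp htp U ⟨hU.1, h⟩ n hn
      · exact h₂ tp htp U ⟨h, hU.2⟩ n hn

end Summit.Ventures.CertifiedManyBodySolver.Theses.CovNdNiO2M21
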